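import Mathlib.AlgebraicGeometry.AffineSpace
import Mathlib.AlgebraicGeometry.Morphisms.Proper
import Mathlib.AlgebraicGeometry.Morphisms.Immersion
import Literature.AlgebraicGeometry.Motives.IntegralProjectiveSpace
import Literature.AlgebraicGeometry.Motives.VarietiesProjectiveSpaceProofs
import Literature.AlgebraicGeometry.Morphisms.AffineFiniteTypeImmersion
import HarnessLib

/-!
# Projective space over a scheme compactifies affine space; affine schemes of finite type are
# compactifiable (Stacks 0F41, first step)

Topic: `Literature/AlgebraicGeometry/Morphisms`. The first step of the Stacks Project's proof of
Nagata's compactification theorem (Tag 0F41, proof, Noetherian case):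

> "For each `i` we can choose an `nᵢ ≥ 0` and an immersion `Uᵢ → 𝐀^{nᵢ}_S` by Morphisms, Lemma
> 40.2 [Tag 04II]. Hence `Uᵢ` has a compactification over `S` for `i = 1, …, n` by taking the
> scheme theoretic image in `𝐏^{nᵢ}_S`."

over an ARBITRARY base scheme `S`. Mathlib has affine space `𝔸(ι; S) = S ×_{Spec ℤ} Spec ℤ[ι]`
(`AlgebraicGeometry.AffineSpace`) but no projective space over a scheme; the tree has projective
space over a RING, `Proj R[x₀,…,xₙ] → Spec R`, proper for finitely many variables
(`Literature.AlgebraicGeometry.Motives.ProjBaseChangeRing.isProper_projToSpec`), with its standard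
charts `(R[x₀,…,xₙ]_{xᵢ})₀ ≅ R[y₁,…,yₙ]`
(`Literature.AlgebraicGeometry.Motives.ProjectiveSpace.chartAlgEquiv`), and Tag 04II for an
affine source (`Literature.AlgebraicGeometry.Morphisms.exists_isImmersion_comp_eq_of_isAffine`).
Here we glue these: `𝐏(ι; S) := S ×_{Spec ℤ} Proj ℤ[x₀,…,xₙ]` (`n = #ι`) is proper over `S` and
receives `𝔸(ι; S)` by an open immersion over `S` (base change of the chart `D₊(x₀) ≅ 𝐀ⁿ_ℤ`),
whence every `S`-scheme with a quasi-compact immersion into some `𝔸(ι; S)` — in particular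
every affine scheme of finite type over `S` — is compactifiable over `S` (scheme-theoretic image
in `𝐏(ι; S)`: a quasi-compact immersion is an open immersion onto its scheme-theoretic image,
whose inclusion is a closed immersion).

## Main results (all proved; no named facts)

* `projectiveSpace ι S` — `𝐏(ι; S) = S ×_{Spec ℤ} Proj ℤ[x₀,…,x_{#ι}]`, with
  `isProper_projectiveSpace_fst : IsProper (𝐏(ι; S) → S)`.
* `affineChart ι` — the open immersion `Spec ℤ[ι] ≅ D₊(x₀) ↪ Proj ℤ[x₀,…,x_{#ι}]`;
  `affineSpaceToProjectiveSpace ι S : 𝔸(ι; S) → 𝐏(ι; S)`, an open immersion over `S`.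
* `exists_compactification_of_isImmersion_affineSpace` — an `S`-scheme with a quasi-compact
  immersion into `𝔸(ι; S)` has a compactification over `S`.
* `exists_compactification_of_isAffine` — **an affine scheme of finite type over any scheme `S`
  has a compactification over `S`** (Stacks 0F41, proof, first step).

## References

* The Stacks Project, Tag 0F41 (proof), Tag 04II, Tag 01WC. [StacksProject]
* R. Hartshorne, *Algebraic Geometry* (1977), II Prop. 2.5 and Thm. 4.9. [Hartshorne1977]
-/

noncomputable section

-- Mathlib's pull-back API is stated through `abbrev`s over `limit`; as in Mathlib's own
-- algebraic-geometry files we let `simp`/unification see through them.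
set_option backward.isDefEq.respectTransparency false

universe u

open CategoryTheory CategoryTheory.Limits AlgebraicGeometry TopologicalSpace MvPolynomial
  HomogeneousLocalization

namespace Literature.AlgebraicGeometry.Morphisms

attribute [local instance] MvPolynomial.gradedAlgebra
  Literature.AlgebraicGeometry.Motives.ProjBaseChange.algebraBase

/-! ## Projective space over `ℤ` and its affine chart -/

section OverInt

variable (ι : Type u) [Finite ι]

/-- The base ring `ℤ` lifted to universe `u` (as in Mathlib's `AffineSpace`). [folklore] -/
abbrev intU : Type u := ULift.{u} ℤ

/-- The homogeneous coordinate ring grading of `ℤ[x₀, …, xₙ]`, `n = #ι`. [folklore] -/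
abbrev grading := homogeneousSubmodule (Fin (Nat.card ι + 1)) (intU.{u})

/-- `𝐏ⁿ_ℤ = Proj ℤ[x₀, …, xₙ]` with `n = #ι`. [folklore] -/
abbrev projectiveSpaceInt : Scheme.{u} := Proj (grading ι)

/-- `𝐏ⁿ_ℤ → Spec ℤ` is proper (`Literature.AlgebraicGeometry.Motives.ProjBaseChangeRing.isProper_projToSpec`).
[cite: Hartshorne1977, Ch. II Thm. 4.9] -/
instance isProper_projToSpec_int :
    IsProper (Motives.ProjBaseChangeRing.projToSpec (Fin (Nat.card ι + 1)) intU.{u}) :=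
  Motives.ProjBaseChangeRing.isProper_projToSpec _ _

/-- Hence the morphism `𝐏ⁿ_ℤ → ⊤` to the terminal scheme is proper (`Spec ℤ` is terminal).
[folklore] -/
instance isProper_terminal_from_projectiveSpaceInt :
    IsProper (terminal.from (projectiveSpaceInt ι)) := by
  haveI := isIso_of_isTerminal specULiftZIsTerminal.{u} terminalIsTerminal (terminal.from _)
  rw [terminal.hom_ext (terminal.from (projectiveSpaceInt ι))
    (Motives.ProjBaseChangeRing.projToSpec (Fin (Nat.card ι + 1)) intU.{u} ≫
      terminal.from (Spec (.of intU.{u})))]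
  infer_instance

/-- The ring of the affine chart `D₊(x₀)`: `ℤ[tᵢ : i ∈ ι] ≅ ℤ[y₁, …, yₙ] ≅ (ℤ[x₀, …, xₙ]_{x₀})₀`
(reindexing along `ι ≃ Fin n`, then the tree's chart isomorphism
`Literature.AlgebraicGeometry.Motives.ProjectiveSpace.chartAlgEquiv`).
[cite: Hartshorne1977, Ch. II Prop. 2.5 (proof)] -/
def chartRingIso : CommRingCat.of (MvPolynomial ι intU.{u}) ≅
    CommRingCat.of (Away (grading ι) (X 0 : MvPolynomial (Fin (Nat.card ι + 1)) intU.{u})) :=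
  (((MvPolynomial.renameEquiv intU.{u} (Finite.equivFin ι)).toRingEquiv).trans
    (Motives.ProjectiveSpace.chartAlgEquiv intU.{u} (0 : Fin (Nat.card ι + 1))).symm.toRingEquiv)
    |>.toCommRingCatIso

/-- **The affine chart** `Spec ℤ[tᵢ : i ∈ ι] ≅ D₊(x₀) ↪ 𝐏ⁿ_ℤ`, an open immersion.
[cite: Hartshorne1977, Ch. II Prop. 2.5] -/
def affineChart : Spec (CommRingCat.of (MvPolynomial ι intU.{u})) ⟶ projectiveSpaceInt ι :=
  Spec.map (chartRingIso ι).inv ≫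
    Proj.awayι (grading ι) (X 0) (Motives.ProjectiveSpace.X_mem (R := intU.{u}) 0) zero_lt_one

/-- The affine chart is an open immersion. [cite: Hartshorne1977, Ch. II Prop. 2.5] -/
instance isOpenImmersion_affineChart : IsOpenImmersion (affineChart ι) := by
  unfold affineChart
  infer_instance

end OverInt

/-! ## Projective space over a scheme -/

section OverScheme

variable (ι : Type u) [Finite ι] (S : Scheme.{u})

/-- **Projective space over a scheme**: `𝐏(ι; S) := S ×_{Spec ℤ} 𝐏ⁿ_ℤ`, `n = #ι` (the product is
taken over the terminal scheme, as for Mathlib's `𝔸(ι; S) = S ×_{Spec ℤ} Spec ℤ[ι]`).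
[cite: StacksProject, Tag 01WC] -/
def projectiveSpace : Scheme.{u} :=
  pullback (terminal.from S) (terminal.from (projectiveSpaceInt ι))

/-- The structure morphism `𝐏(ι; S) → S`. [folklore] -/
abbrev projectiveSpaceFst : projectiveSpace ι S ⟶ S :=
  pullback.fst (terminal.from S) (terminal.from (projectiveSpaceInt ι))

/-- **`𝐏(ι; S) → S` is proper** (base change of the proper `𝐏ⁿ_ℤ → Spec ℤ`).
[cite: StacksProject, Tag 01WC] -/
instance isProper_projectiveSpaceFst : IsProper (projectiveSpaceFst ι S) := by
  unfold projectiveSpaceFst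
  infer_instance

/-- **Affine space is an open subscheme of projective space over any base**: the morphism
`𝔸(ι; S) = S ×_ℤ Spec ℤ[ι] → S ×_ℤ 𝐏ⁿ_ℤ = 𝐏(ι; S)` induced by the affine chart.
[cite: StacksProject, Tag 0F41 (proof)] -/
def affineSpaceToProjectiveSpace : 𝔸(ι; S) ⟶ projectiveSpace ι S :=
  pullback.map (terminal.from S) (terminal.from (Spec (.of (MvPolynomial ι (ULift.{u} ℤ)))))
    (terminal.from S) (terminal.from (projectiveSpaceInt ι)) (𝟙 S) (affineChart ι) (𝟙 _)
    (by simp) (terminal.hom_ext _ _)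

/-- `𝔸(ι; S) → 𝐏(ι; S)` is a morphism over `S`. [folklore] -/
@[reassoc]
theorem affineSpaceToProjectiveSpace_fst :
    affineSpaceToProjectiveSpace ι S ≫ projectiveSpaceFst ι S = 𝔸(ι; S) ↘ S := by
  rw [affineSpaceToProjectiveSpace, projectiveSpaceFst, pullback.lift_fst, Category.comp_id]
  rfl

/-- `𝔸(ι; S) → 𝐏(ι; S)` is an open immersion (base change of the affine chart).
[cite: StacksProject, Tag 0F41 (proof)] -/
instance isOpenImmersion_affineSpaceToProjectiveSpace :
    IsOpenImmersion (affineSpaceToProjectiveSpace ι S) := by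
  unfold affineSpaceToProjectiveSpace
  exact MorphismProperty.pullbackMap (P := @IsOpenImmersion) inferInstance inferInstance
    (by simp) (terminal.hom_ext _ _)

end OverScheme

/-! ## Compactifications -/

section Compactification

variable {X S : Scheme.{u}}

/-- **An `S`-scheme with a quasi-compact immersion into an affine space `𝔸(ι; S)` (`ι` finite) has a
compactification over `S`**: compose with `𝔸(ι; S) ↪ 𝐏(ι; S)` and factor the resulting
quasi-compact immersion through its scheme-theoretic image (Mathlib `Scheme.Hom.toImage`, an open
immersion, and `Scheme.Hom.imageι`, a closed immersion), which is proper over `S`.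
[cite: StacksProject, Tag 0F41 (proof)] -/
theorem exists_compactification_of_isImmersion_affineSpace (ι : Type u) [Finite ι]
    (i : X ⟶ 𝔸(ι; S)) [IsImmersion i] [QuasiCompact i] :
    ∃ (Xc : Scheme.{u}) (j : X ⟶ Xc) (g : Xc ⟶ S),
      IsOpenImmersion j ∧ IsProper g ∧ j ≫ g = i ≫ (𝔸(ι; S) ↘ S) := by
  set k := i ≫ affineSpaceToProjectiveSpace ι S with hk
  haveI : IsImmersion k := inferInstance
  -- `k` is quasi-compact: `k ≫ (𝐏 → S) = i ≫ (𝔸 → S)` is, and `𝐏 → S` is separated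
  haveI : QuasiCompact (k ≫ projectiveSpaceFst ι S) := by
    rw [hk, Category.assoc, affineSpaceToProjectiveSpace_fst]
    infer_instance
  haveI : QuasiCompact k := .of_comp k (projectiveSpaceFst ι S)
  refine ⟨k.image, k.toImage, k.imageι ≫ projectiveSpaceFst ι S, inferInstance, inferInstance, ?_⟩
  rw [k.toImage_imageι_assoc, hk, Category.assoc, affineSpaceToProjectiveSpace_fst]

/-- **An affine scheme of finite type over any scheme `S` has a compactification over `S`**
(Stacks 0F41, proof, first step: "we can choose an `nᵢ ≥ 0` and an immersion `Uᵢ → 𝐀^{nᵢ}_S`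
[…]. Hence `Uᵢ` has a compactification over `S` […] by taking the scheme theoretic image in
`𝐏^{nᵢ}_S`"): the immersion is Tag 04II
(`Literature.AlgebraicGeometry.Morphisms.exists_isImmersion_comp_eq_of_isAffine`); it is
quasi-compact because `X → S` is and `𝔸(ι; S) → S` is separated.
[cite: StacksProject, Tag 0F41 (proof)] -/
theorem exists_compactification_of_isAffine [IsAffine X] (f : X ⟶ S) [LocallyOfFiniteType f]
    [QuasiCompact f] :
    ∃ (Xc : Scheme.{u}) (j : X ⟶ Xc) (g : Xc ⟶ S), IsOpenImmersion j ∧ IsProper g ∧ j ≫ g = f := by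
  obtain ⟨ι, _, i, hi, hfac⟩ := exists_isImmersion_comp_eq_of_isAffine f
  haveI := hi
  haveI : QuasiCompact (i ≫ (𝔸(ι; S) ↘ S)) := hfac ▸ inferInstance
  haveI : QuasiCompact i := .of_comp i (𝔸(ι; S) ↘ S)
  obtain ⟨Xc, j, g, hj, hg, h⟩ := exists_compactification_of_isImmersion_affineSpace ι i
  exact ⟨Xc, j, g, hj, hg, h.trans hfac⟩

end Compactification

end Literature.AlgebraicGeometry.Morphisms

end
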